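import Summits.Ventures.QEC.Census.CertCheck
import HarnessLib

/-!
# Controls for the distance-certificate checker (plan/CERT-REQS.md §6 A2, A3): Steane `[[7,1,3]]` and
# Shor `[[9,1,3]]`, tier KERNEL

The two further acceptance controls of CERT-REQS §6 (A1 = `[[4,2,2]]` is `certC422` in `Census/CertCheck.lean`),
transcribed from kernel A's certificates `cert/examples/steane7.certA.json` (id a62a4529fdadd18e…) and
`cert/examples/shor9.certA.json` (id 544382fb90808f73…) (qec-search-1; generators as in Gottesman 1997 Table 3.1 /
Nielsen–Chuang §10.5 — locators are lit-1's register, the matrices here are DATA checked by the kernel, not cited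
facts) by qec-type-10's reference converter `tools/json2lean.py` (supports ↦ bitmasks, bit `j` = qubit `j`).
Both are closed by `decide` (tier KERNEL): the printed `d = 3` of these two codes is thereby CERTIFIED for the
explicit matrices below (as `d_Z = d_X = 3` of type-02's `CSSCode`; `d = min d_X d_Z` by `cssMinDist_eq_min_dX_dZ`).
Shor's `Z` side exercises a NON-EMPTY allow-list (nine weight-2 `Z`-stabilizers `Z_iZ_j` inside the blocks).
-/

namespace Summit.Ventures.QEC.Census

/-- Steane `[[7,1,3]]` (CLAIM as printed; CERT-REQS A2): `HX = HZ =` the three Hamming `[7,4]` checks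
`{0,2,4,6}, {1,2,5,6}, {3,4,5,6}`; witnesses `Z₀Z₁Z₂` / `X₀X₁X₂`; brute force `wmax = 2`, empty allow-lists.
Source file cert/examples/steane7.certA.json (kernel A, matrix_sha256 ac0cb62124af1b5b…). -/
def certSteane7 : DistCert where
  n := 7
  HX := [85, 102, 120]
  HZ := [85, 102, 120]
  sideZ := { d := 3, witness := 7, nonmember := 7, found := [] }
  sideX := { d := 3, witness := 7, nonmember := 7, found := [] }

/-- The checker accepts the Steane certificate (`decide`, tier KERNEL). -/
theorem checkDistCert_certSteane7 : certSteane7.checkDistCert = true := by decide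

/-- `d_Z = 3` for the Steane code — CERTIFIED. -/
theorem dZ_certSteane7 : (certSteane7.code (certSteane7.commOK_of_check checkDistCert_certSteane7)).dZ = 3 :=
  certSteane7.dZ_code checkDistCert_certSteane7

/-- `d_X = 3` for the Steane code — CERTIFIED. -/
theorem dX_certSteane7 : (certSteane7.code (certSteane7.commOK_of_check checkDistCert_certSteane7)).dX = 3 :=
  certSteane7.dX_code checkDistCert_certSteane7

/-- Shor `[[9,1,3]]` (CLAIM as printed; CERT-REQS A3): `HX = {0..5}, {3..8}`; `HZ =` the six pairs `Z₀Z₁, Z₁Z₂,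
Z₃Z₄, Z₄Z₅, Z₆Z₇, Z₇Z₈`; witnesses `Z₀Z₃Z₆` / `X₀X₁X₂`; brute force `wmax = 2`; the `Z` allow-list = the nine
weight-2 `Z`-stabilizers with their row decompositions. Source file cert/examples/shor9.certA.json (kernel A,
matrix_sha256 22c5661cade9dad8…). -/
def certShor9 : DistCert where
  n := 9
  HX := [63, 504]
  HZ := [3, 6, 24, 48, 192, 384]
  sideZ := { d := 3, witness := 73, nonmember := 7,
             found := [(3, [0]), (5, [0, 1]), (6, [1]), (24, [2]), (40, [2, 3]), (48, [3]), (192, [4]),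
               (320, [4, 5]), (384, [5])] }
  sideX := { d := 3, witness := 7, nonmember := 73, found := [] }

/-- The checker accepts the Shor certificate (`decide`, tier KERNEL). -/
theorem checkDistCert_certShor9 : certShor9.checkDistCert = true := by decide

/-- `d_Z = 3` for the Shor code — CERTIFIED. -/
theorem dZ_certShor9 : (certShor9.code (certShor9.commOK_of_check checkDistCert_certShor9)).dZ = 3 :=
  certShor9.dZ_code checkDistCert_certShor9

/-- `d_X = 3` for the Shor code — CERTIFIED. -/
theorem dX_certShor9 : (certShor9.code (certShor9.commOK_of_check checkDistCert_certShor9)).dX = 3 :=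
  certShor9.dX_code checkDistCert_certShor9


/-! ## Negative control (CERT-REQS §6 A4 / C11): a tampered certificate is REJECTED -/

/-- The `[[4,2,2]]` certificate with the claimed `Z`-distance tampered to `3` (witness and allow-list unchanged). -/
def certC422_tamperedZ3 : DistCert where
  n := 4
  HX := [15]
  HZ := [15]
  sideZ := { d := 3, witness := 3, nonmember := 5, found := [] }
  sideX := { d := 2, witness := 5, nonmember := 3, found := [] }

/-- **A4 negative control**: the checker REJECTS the tampered certificate (`decide`): the weight-2 witness does not
have weight 3, and the brute-force replay with `wmax = 2` meets the zero-syndrome words `Z₀Z₁, …` that are not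
allow-listed. -/
theorem checkDistCert_certC422_tamperedZ3 : certC422_tamperedZ3.checkDistCert = false := by decide

/-- The `[[4,2,2]]` certificate with the `Z`-side non-membership witness tampered (`{0,2} ↦ {2,3}`: still in
`ker H^Z`, but its overlap with the upper witness `Z₀Z₁` is now empty, hence even). -/
def certC422_tamperedWitness : DistCert where
  n := 4
  HX := [15]
  HZ := [15]
  sideZ := { d := 2, witness := 3, nonmember := 12, found := [] }
  sideX := { d := 2, witness := 5, nonmember := 3, found := [] }

/-- **A4 negative control (witness)**: REJECTED — the tampered non-membership witness `{2,3}` has even overlap with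
the upper witness `Z₀Z₁`, so non-membership in the stabilizer row space is no longer certified. -/
theorem checkDistCert_certC422_tamperedWitness : certC422_tamperedWitness.checkDistCert = false := by decide

end Summit.Ventures.QEC.Census
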